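import Mathlib
import HarnessLib
import Summits.ValiantsHypothesis.ValiantsHypothesis.Theses.MonotoneRestoration
import Literature.Computability.AlgebraicComplexity.ArithCircuit
import Literature.Computability.AlgebraicComplexity.ArithCircuitProofs
import Literature.Computability.AlgebraicComplexity.MonotoneStructure
import Literature.Computability.AlgebraicComplexity.PermanentIrreducible
import Literature.ModelTheory.FiniteModelTheory.CkEquiv
import Summits.ValiantsHypothesis.ValiantsHypothesis.Theorems.MonotoneRestorationMonotoneRestorationQPCosetCount
import Summits.ValiantsHypothesis.ValiantsHypothesis.Theorems.MonotoneRestorationMonotoneRestorationQPSymmetricLB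
import Summits.ValiantsHypothesis.ValiantsHypothesis.Theorems.MonotoneRestorationMonotoneRestorationQPSupportSymmetrisation
import Summits.ValiantsHypothesis.ValiantsHypothesis.Theorems.MonotoneRestorationMonotoneRestorationQPSparseRegime
import Summits.ValiantsHypothesis.ValiantsHypothesis.Theorems.MonotoneRestorationMonotoneRestorationQPBeta
import Literature.Computability.AlgebraicComplexity.SymmetricArithCircuit
import Literature.Computability.AlgebraicComplexity.DawarWilsenach2025Proofs
import Literature.GroupTheory.PermutationGroups.SmallIndexSubgroups
import Summits.ValiantsHypothesis.ValiantsHypothesis.Theorems.MonotoneRestorationQP.Negative.LoadBearing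
import Summits.ValiantsHypothesis.ValiantsHypothesis.Theorems.MonotoneRestorationMonotoneRestorationQPPermSupportCount

/-! TTRL-lite variant V19007 of stmt-ValiantsHypothesis-15886

Move `generalise` (boundary probe): the stub `stub_altFixing_orbit_dichotomy` with the sign
condition `Equiv.Perm.sign ρ = 1` dropped from the CONCLUSION (every `ρ` fixing `X` pointwise must
fix `q`) while the orbit hypothesis `horb` still only speaks about EVEN `ρ`.  This is FALSE — an
`Alt`-invariant polynomial need not be `Sym`-invariant (chirality) — and the negation is proved
here by an explicit alternating witness at `n = 9` over `K = ℤ`.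
-/

-- `Summit.ValiantsHypothesis.ValiantsHypothesis.…` is the tree's mandated single-conjunct layout
-- (Sub = Summit), so the duplicated namespace component is intended.
set_option linter.dupNamespace false

namespace Summit.ValiantsHypothesis.ValiantsHypothesis.Theorems

open Summit.ValiantsHypothesis.ValiantsHypothesis.Theses.MonotoneRestoration
open Literature.Computability.AlgebraicComplexity

/-- **TTRL-lite variant V19007 of `stub_altFixing_orbit_dichotomy` is FALSE** (move `generalise`:
the conclusion is asked for ALL `ρ` fixing `X` pointwise, not only the even ones, while `horb`
still only constrains even `ρ`).  The sign condition in the stub's conclusion is load-bearing.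

Chirality witness: `n = 9`, `K = ℤ`, `X = ∅`, `q = det (vandermonde (i ↦ x_{ii}))`, the
Vandermonde determinant `∏_{i<j} (x_{jj} - x_{ii})` in the diagonal variables, and `T = {q}`
(so `|T| + |X| = 1 < 9`).  The diagonal relabelling `x_{ab} ↦ x_{ρa,ρb}` permutes the rows of the
Vandermonde matrix, so `rename ρ q = sign ρ · q` (`AlgHom.map_det`, `Matrix.det_permute`): every
even `ρ` fixes `q` (hence `horb`), but the transposition `(0 1)` sends `q` to `-q ≠ q`, because
`q ≠ 0` (`Matrix.det_vandermonde_ne_zero_iff` in the domain `ℤ[x_{ab}]`, the diagonal variables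
being pairwise distinct, `MvPolynomial.X_injective`) and `ℤ[x_{ab}]` has characteristic zero
(`CharZero.neg_eq_self_iff`). -/
theorem stub_altFixing_orbit_dichotomy_var19007_false :
    ¬ (∀ (n : ℕ) (K : Type) [CommSemiring K] (q : MvPolynomial (Fin n × Fin n) K)
        (X : Finset (Fin n)) (h8 : X.card + 9 ≤ n)
        (T : Finset (MvPolynomial (Fin n × Fin n) K)) (hT : T.card + X.card < n)
        (horb : ∀ ρ : Equiv.Perm (Fin n), (∀ x ∈ X, ρ x = x) → Equiv.Perm.sign ρ = 1 →
          MvPolynomial.rename (fun p : Fin n × Fin n => (ρ p.1, ρ p.2)) q ∈ T),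
        ∀ ρ : Equiv.Perm (Fin n), (∀ x ∈ X, ρ x = x) →
          MvPolynomial.rename (fun p : Fin n × Fin n => (ρ p.1, ρ p.2)) q = q) := by
  intro h
  -- the witness: the Vandermonde determinant in the diagonal variables `x_{ii}` over `ℤ`
  let v : Fin 9 → MvPolynomial (Fin 9 × Fin 9) ℤ := fun i => MvPolynomial.X (i, i)
  let q : MvPolynomial (Fin 9 × Fin 9) ℤ := (Matrix.vandermonde v).det
  -- `q` is alternating under the diagonal relabelling
  have key : ∀ ρ : Equiv.Perm (Fin 9),
      MvPolynomial.rename (fun p : Fin 9 × Fin 9 => (ρ p.1, ρ p.2)) q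
        = Equiv.Perm.sign ρ * q := by
    intro ρ
    show MvPolynomial.rename (fun p : Fin 9 × Fin 9 => (ρ p.1, ρ p.2))
        (Matrix.vandermonde v).det = Equiv.Perm.sign ρ * (Matrix.vandermonde v).det
    rw [AlgHom.map_det, ← Matrix.det_permute]
    congr 1
    ext i j
    simp [v, Matrix.vandermonde_apply, MvPolynomial.rename_X]
  -- the diagonal variables are pairwise distinct, so `q ≠ 0`
  have hinj : Function.Injective v := by
    intro i j hij
    have hij' : (MvPolynomial.X (i, i) : MvPolynomial (Fin 9 × Fin 9) ℤ)
        = MvPolynomial.X (j, j) := hij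
    exact congrArg Prod.fst (MvPolynomial.X_injective hij')
  have hq : q ≠ 0 := Matrix.det_vandermonde_ne_zero_iff.mpr hinj
  -- specialise the (false) statement to the witness and the transposition `(0 1)`
  have h1 := h 9 ℤ q ∅ (by simp) {q} (by simp)
    (by
      intro ρ _ hρ
      rw [key ρ, hρ, Units.val_one, Int.cast_one, one_mul]
      exact Finset.mem_singleton_self q)
    (Equiv.swap 0 1) (fun x hx => absurd hx (Finset.notMem_empty x))
  rw [key, Equiv.Perm.sign_swap (by decide), Units.val_neg, Units.val_one, Int.cast_neg,
    Int.cast_one, neg_one_mul] at h1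
  -- `h1 : -q = q`, impossible in characteristic zero for `q ≠ 0`
  exact hq (CharZero.neg_eq_self_iff.mp h1)

end Summit.ValiantsHypothesis.ValiantsHypothesis.Theorems
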